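import Summits.QuantumFields.YangMills.Theorems.BalabanUVNodesN18CombStepFirstOrderFrame
import HarnessLib

/-!
# BalabanUVNodes ∕ node N18 = NE5 — closure-ledger item (iii), the (1.13) half of the comb-gauge step, FILE C (the orbit statement):
# (i)–(iii) FOR THE COMB-GAUGED PAIR `(𝐔, 𝐉)^{exp(−l)}` ON THE FRAMES OF RECORD, AND THE (T3′) CONSEQUENT `∃ w ∈ Gᶜ, SatisfiesI_III … (act w Φ)`
# AT THE `SU(N)` MODEL OF RECORD (Track A, DAG node N18 = `T4OutputRate.NE5` :211; cluster K4 «SpineRates», item K3⁷ `SpineGivenEndpointR13SepCoPH`;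
# seat pub-ymgap-dag-n18-w3 g3)

CREDIT.  Homes §3 (end) ∕ §4 ∕ §5 ∕ §6 of the LENS seat's farm-checked scratch `ym-lens-BalabanUVNodes-transfer` g32 `LensTransferSketch32.lean` (memo
`LENS-transfer.md` §38, Card T49; bus 2026-08-27 [LENS-TRANSFER-G32-1]) per its close-out pointer «home the files … WITH CREDIT» (g35), stated directly at the
frames of record `frameI Rz M j Y` (see FILE B's docstring for the one located re-cut).  The proofs are the lens's.

HONEST FRAMING.  Count-neutral kernel bookkeeping (`--supports stmt-QuantumFields-20544 --as helper`): Banach-algebra estimates over the tree's near-(3.29)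
lineage, PROVED; the SHAPE of the last theorem is exactly the consequent of the displayed analysis input `hsat` of
`YMDAG.N18.TransportOfRecord.admTransport_spaceOfRecord_unit_ofRecord_orbit` (at `Φ := TΦOfRecord F N k Φ₀`, `Rz := Residual.unit`,
`c := StepConsts.ofParams … j`, `γ₀′ := α₀′`) — but its HYPOTHESES (the six letters `a, a₁, δ₀, δ₁, s₀, s₁` of the transported pair at the radii of record, the
comb generator `l = λ̄` and its letters, (i) of the factor, (iii) of the transported pair) are item 3 proper of `N18-BETA-SPEC.md` and are NOT produced here.
NE5 is NOT PRINTED and NOT proved; N18 is NOT discharged; nothing about the continuum limit ∕ OS ∕ mass gap ∕ Clay.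

WHAT.
* §1 ★ `satisfiesI_III_act_near_firstOrder_frameI` — (i)–(iii) for `(𝐔, 𝐉)^{w·e}`, `e = exp iξE`, from explicit factorisation data and the letters of the
  first-order sum (the factorisation witness is `(U^w, R(w)A″)` ON the bonds of `X` — `B12Spaces329NearBond.gaugeU_factor_near` — and the trivial one off `X`;
  (i) by `condI_gaugeU` + `condI_mono`, (ii) by FILE B's ★, (iii) by `condIII_near_frameI`).
* §2 ★★ `satisfiesI_III_act_comb_firstOrder_frameI` — the complex comb gauge `w = exp(−l)`: `E = (i∕ξ)•l`, first-order sum `A′ − i•∇^ξ_U l`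
  (FILE A `expI_comb`, `firstOrder_comb`); ★★ `exists_orbit_comb_firstOrder_frameI` — the orbit statement
  `∃ w, (∀ x, w x ∈ Gᶜ) ∧ SatisfiesI_III 𝓜 (frameI Rz M j Y) c α₀′ α₁′ γ₀′ (act w Φ)`.
* §3 ★★★ `exists_orbit_comb_firstOrder_frameI_su` — at the model of record `suModel N` (`G = SU(N)`, `Gᶜ = SL(N, ℂ)`, `𝔤ᶜ = 𝔰𝔩(N, ℂ)`,
  `Node00.Record12` ∕ `B12RegularSpaces111SpecialUnitary`) with the standing provisos DISCHARGED (`suModel_norm_le`, `suModel_G_le_Gc`, `suModel_gc_conj`,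
  `suModel_gc_newPot`, `suModel_expI_mem_Gc`, `suModel_gc_conjE`) and the algebra hypotheses reduced to TRACES (`A′` traceless on the bonds of `X`, `l` traceless).

0 `def`, 0 `sorry`.  References: T. Bałaban, CMP **109** (1987) 249–301 [Balaban1987RG1] ((1.10)–(1.14) p.262, (3.29) p.281); CMP **98** (1985) 17–51
[Balaban1985Averaging] ((62)–(63) p.29).
-/

namespace YMDAG.N18.CombStep

open NormedSpace
open Literature.MathematicalPhysics.QuantumFieldTheory.Balaban1983to89
open Literature.MathematicalPhysics.QuantumFieldTheory.Balaban1983to89.B12RegularSpaces111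
open Literature.MathematicalPhysics.QuantumFieldTheory.Balaban1983to89.B12RegularSpaces111Gauge
open Literature.MathematicalPhysics.QuantumFieldTheory.Balaban1983to89.B12RegularSpaces111Mono
open Literature.MathematicalPhysics.QuantumFieldTheory.Balaban1983to89.B12Membership314
open Literature.MathematicalPhysics.QuantumFieldTheory.Balaban1983to89.B12Membership313II
open Literature.MathematicalPhysics.QuantumFieldTheory.Balaban1983to89.B12Spaces329BCH
open Literature.MathematicalPhysics.QuantumFieldTheory.Balaban1983to89.B12Spaces329NearBond
open Literature.MathematicalPhysics.QuantumFieldTheory.Balaban1983to89.B12Spaces329Near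
open Literature.MathematicalPhysics.QuantumFieldTheory.Balaban1983to89.B12Spaces329NearSharp
open Complex (I)
open Literature.MathematicalPhysics.QuantumFieldTheory.Balaban1983to89.Node00
open Literature.MathematicalPhysics.QuantumFieldTheory.Balaban1983to89.Node00.Sect2

noncomputable section

variable {𝔸 : Type*} [NormedRing 𝔸] [NormedAlgebra ℂ 𝔸] [CompleteSpace 𝔸]

/-! ## §1 ★ (i)–(iii) for `(𝐔, 𝐉)^{w·e}` in first-order-sum form on the frame of record -/

section Lattice

variable {P : Params} {𝓜 : Model 𝔸}

/-- ★ **(i)–(iii) for `(𝐔, 𝐉)^{w·e}`, `e = exp iξE`, first-order-sum form, frame of record on `Y`.**  Explicit factorisation data `𝐔 = (exp iξA′)U` with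
(i) at `α₀` on the frame, (iii) at `(α₀, γ₀)` on `X`, `A′` `𝔤ᶜ`-valued with `|A′| ≤ a` on the bonds and `|∇^ξ_U A′| ≤ a₁` on the stencils of `X`,
`E` as in `condII_near_firstOrder_frameI` with `exp iξE(x) ∈ Gᶜ` and `Ad(exp iξE(x))` preserving `𝔤ᶜ` for `x ∈ Y`, and the letters `s₀, s₁` of
`S = E₋ + A′ − R(U)E₊` on `X`.  Then `(𝐔, 𝐉)^{w·e}` satisfies (i)–(iii) on the frame with any `α₀′ ≥ e^{2ξδ₀}α₀`, `γ₀′ ≥ e^{2ξδ₀}γ₀` and `α₁′`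
as in `condII_near_firstOrder_frameI`.  The factorisation witness is `(U^w, R(w)A″)` ON THE BONDS OF `X` (`B12Spaces329NearBond.gaugeU_factor_near`,
bondwise) and the trivial factorisation `(𝐔^{w·e}, 0)` off `X` (conditions (i)–(ii) read the bonds of `X` only: `condI_congr_frameI`, `condII_congr_frameI`);
(i) by `condI_gaugeU` + `condI_mono`, (iii) by `condIII_near_frameI`.  Compare `B12Spaces329NearSharp.satisfiesI_III_act_near_sharp` (whole lattice). -/
theorem satisfiesI_III_act_near_firstOrder_frameI (hG1 : ∀ g ∈ 𝓜.G, ‖(g : 𝔸)‖ ≤ 1) (hGc : 𝓜.G ≤ 𝓜.Gc)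
    (hgc : ∀ g ∈ 𝓜.G, ∀ X ∈ 𝓜.gc, (g : 𝔸) * X * ↑g⁻¹ ∈ 𝓜.gc)
    {c : StepConsts} (hgcN : ∀ X ∈ 𝓜.gc, ∀ Y ∈ 𝓜.gc, c.ξ * (‖X‖ + ‖Y‖) ≤ 1 / 4 → newPot c.ξ X Y ∈ 𝓜.gc)
    (Rz : Residual P 𝔸) (M j : ℕ) (Y : Set (Site P 0)) (hξ : 0 < c.ξ) (hcB : 0 ≤ c.cB)
    {α₀ γ₀ a a₁ δ₀ δ₁ s₀ s₁ α₀' α₁' γ₀' : ℝ} (hα₀ : 0 ≤ α₀) (ha : 0 ≤ a) (hδ₀ : 0 ≤ δ₀)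
    (hs : c.ξ * (a + 2 * δ₀) ≤ 1 / 16)
    (hα₀' : Real.exp (2 * (c.ξ * δ₀)) * α₀ ≤ α₀') (hγ₀' : Real.exp (2 * (c.ξ * δ₀)) * γ₀ ≤ γ₀')
    (hα₁'0 : s₀ + 4 * c.ξ * δ₀ * (a + δ₀) ≤ α₁')
    (hα₁'1 : s₁ + (4 * c.ξ * (δ₀ * a₁ + a * (2 * c.ξ * α₀ * δ₀ + δ₁)) +
        4 * c.ξ * ((a + (9 / 8) * δ₀) * δ₁ +
          δ₀ * ((1 + 4 * (c.ξ * δ₀)) * a₁ + (1 + 4 * (c.ξ * a)) * (2 * c.ξ * α₀ * δ₀ + δ₁)))) ≤ α₁')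
    {Φ : FieldPair P 0 𝔸ˣ 𝔸} (hUGc : ∀ b ∈ (frameI Rz M j Y).X.bonds, Φ.U b ∈ 𝓜.Gc) (hJgc : ∀ b ∈ (frameI Rz M j Y).X.bonds, Φ.J b ∈ 𝓜.gc)
    {U : PBond P 0 → 𝔸ˣ} {A' : PBond P 0 → 𝔸} (hf : Factors c Φ.U U A') (hI : CondI 𝓜 (frameI Rz M j Y) c α₀ U)
    (hAgc : ∀ b ∈ (frameI Rz M j Y).X.bonds, A' b ∈ 𝓜.gc) (hA : ∀ b ∈ (frameI Rz M j Y).X.bonds, ‖A' b‖ ≤ a)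
    (hA1 : ∀ q ∈ (frameI Rz M j Y).X.dpairs, ‖nabla c.ξ U q.2.1 (fun y => A' ⟨y, q.2.2⟩) q.1‖ ≤ a₁)
    (hIII : CondIII (frameI Rz M j Y).X c α₀ γ₀ Φ.U Φ.J)
    {w : Site P 0 → 𝔸ˣ} (hw : ∀ x, w x ∈ 𝓜.G) {E : Site P 0 → 𝔸} (hEgc : ∀ x ∈ Y, E x ∈ 𝓜.gc)
    (heGc : ∀ x ∈ Y, expI c.ξ (E x) ∈ 𝓜.Gc)
    (hgcE : ∀ x ∈ Y, ∀ X ∈ 𝓜.gc, (expI c.ξ (E x) : 𝔸) * X * ↑(expI c.ξ (E x))⁻¹ ∈ 𝓜.gc)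
    (hE0 : ∀ x ∈ Y, ‖E x‖ ≤ δ₀) (hE1 : ∀ (x : Site P 0) (μ : Fin P.d), x ∈ Y → x.shift μ ∈ Y → ‖nabla c.ξ U μ E x‖ ≤ δ₁)
    (hS0 : ∀ b ∈ (frameI Rz M j Y).X.bonds, ‖E b.src + A' b + (U b : 𝔸) * (-E b.tgt) * ↑(U b)⁻¹‖ < s₀)
    (hS1 : ∀ q ∈ (frameI Rz M j Y).X.dpairs, ‖nabla c.ξ U q.2.1
      (fun y => E y + A' ⟨y, q.2.2⟩ + (U ⟨y, q.2.2⟩ : 𝔸) * (-E (y.shift q.2.2)) * ↑(U ⟨y, q.2.2⟩)⁻¹) q.1‖ < s₁) :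
    SatisfiesI_III 𝓜 (frameI Rz M j Y) c α₀' α₁' γ₀' (act (w * fun x => expI c.ξ (E x)) Φ) := by
  classical
  have hUG : ∀ b ∈ (frameI Rz M j Y).X.bonds, U b ∈ 𝓜.G := hI.gValued
  have hα₀le : α₀ ≤ α₀' := by
    have : (1 : ℝ) * α₀ ≤ Real.exp (2 * (c.ξ * δ₀)) * α₀ :=
      mul_le_mul_of_nonneg_right (Real.one_le_exp (by positivity)) hα₀
    linarith
  have hv : ∀ x ∈ Y, (w * fun x => expI c.ξ (E x)) x ∈ 𝓜.Gc := fun x hx => 𝓜.Gc.mul_mem (hGc (hw x)) (heGc x hx)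
  -- the new potential on `X`, the trivial factorisation off `X`
  set N : PBond P 0 → 𝔸 := fun b => newPot c.ξ (E b.src) (newPot c.ξ (A' b) ((U b : 𝔸) * (-E b.tgt) * ↑(U b)⁻¹))
    with hNdef
  let U₁ : PBond P 0 → 𝔸ˣ := fun b => if b ∈ (frameI Rz M j Y).X.bonds then gaugeU w U b else (act (w * fun x => expI c.ξ (E x)) Φ).U b
  let A₁ : PBond P 0 → 𝔸 := fun b => if b ∈ (frameI Rz M j Y).X.bonds then adJ w N b else 0
  have hU₁ : ∀ b ∈ (frameI Rz M j Y).X.bonds, U₁ b = gaugeU w U b := fun b hb => if_pos hb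
  have hA₁ : ∀ b ∈ (frameI Rz M j Y).X.bonds, A₁ b = adJ w N b := fun b hb => if_pos hb
  refine ⟨fun b hb => ?_, fun b hb => ?_, U₁, A₁, fun b => ?_, ?_, ?_, ?_⟩
  · -- `𝐔^v` is `Gᶜ`-valued on `X`
    exact 𝓜.Gc.mul_mem (𝓜.Gc.mul_mem (hv _ (mem_bonds_frameI_src hb)) (hUGc b hb)) (𝓜.Gc.inv_mem (hv _ (mem_bonds_frameI_tgt hb)))
  · -- `R(v)𝐉` is `𝔤ᶜ`-valued on `X`
    have e : (act (w * fun x => expI c.ξ (E x)) Φ).J = adJ w (adJ (fun x => expI c.ξ (E x)) Φ.J) := adJ_mul _ _ _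
    rw [e]
    exact hgc _ (hw _) _ (hgcE _ (mem_bonds_frameI_src hb) _ (hJgc b hb))
  · -- the factorisation
    by_cases hb : b ∈ (frameI Rz M j Y).X.bonds
    · rw [hU₁ b hb, hA₁ b hb]
      have h1 := (norm_newPot2_le_sharp hG1 hξ ha hδ₀ hs (hUG b hb) (hE0 _ (mem_bonds_frameI_tgt hb)) (hA b hb)).1
      have h2 := (norm_newPot3_le_sharp hG1 hξ ha hδ₀ hs (hUG b hb) (hE0 _ (mem_bonds_frameI_src hb)) (hE0 _ (mem_bonds_frameI_tgt hb))
        (hA b hb)).1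
      exact gaugeU_factor_near hξ w E b (hf b) (h1.trans (by norm_num)) (h2.trans (by norm_num))
    · have eU : U₁ b = (act (w * fun x => expI c.ξ (E x)) Φ).U b := if_neg hb
      have eA : A₁ b = 0 := if_neg hb
      rw [eU, eA, expI_zero, one_mul]
  · exact condI_congr_frameI Rz M j Y hU₁ (condI_mono hcB hα₀le (condI_gaugeU hG1 hw hI))
  · exact condII_congr_frameI Rz M j Y hU₁ hA₁ (condII_near_firstOrder_frameI hG1 hgc hgcN Rz M j Y hξ hα₀ ha hδ₀ hs hα₁'0 hα₁'1 hI hAgc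
      hA hA1 hw hEgc hE0 hE1 hS0 hS1)
  · exact condIII_near_frameI hG1 Rz M j Y hξ.le hα₀ hα₀' hγ₀' hw hE0 hIII

/-! ## §2 ★★ The complex comb gauge `e = exp(−l)`: `E = (i∕ξ)•l`, first-order sum `A′ − i•∇^ξ_U l`; the orbit statement -/

/-- ★★ **(i)–(iii) for the comb-gauged pair `(𝐔, 𝐉)^{exp(−l)}` from the letters of `A′ − i∇^ξ_U l`, frame of record on `Y`.**  As
`satisfiesI_III_act_near_firstOrder_frameI` with `w = 1`, `E = (i/ξ)•l` (`l` `𝔤ᶜ`-valued with `|l| ≤ ξδ₀` on `Y`, `|∇^ξ_{U,μ}l(x)| ≤ ξδ₁` for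
`x, x+μ ∈ Y`, `exp(−l(x)) ∈ Gᶜ` and `Ad(exp(−l(x)))` preserving `𝔤ᶜ` for `x ∈ Y`, `𝔤ᶜ` a `ℂ`-subspace), the first-order letters now being those of
`A′(b) − i•(∇^ξ_{U,ν}l)(x)`: `< s₀` on the bonds and `|∇^ξ_{U,μ}(A′_ν − i∇^ξ_{U,ν}l)| < s₁` on the stencils of `X`.  For the N18 comb gauge `l = λ̄`
(`|λ̄| = O(d·ξα₁)`: `δ₀ = O(dα₁)`) the displayed excess over `(s₀, s₁)` is `O(ξ·d²·α₁²)` — relative `O(ξd²α₁)`, level-geometric — whereas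
`satisfiesI_III_act_near_sharp` applied to the same `E` charges `(3 + 12α₁ + 3ξα₀)δ₀ + 4δ₁ = O(d·α₁)` on top of the (ii)-budget of `A′`. -/
theorem satisfiesI_III_act_comb_firstOrder_frameI (hG1 : ∀ g ∈ 𝓜.G, ‖(g : 𝔸)‖ ≤ 1) (hGc : 𝓜.G ≤ 𝓜.Gc)
    (hgc : ∀ g ∈ 𝓜.G, ∀ X ∈ 𝓜.gc, (g : 𝔸) * X * ↑g⁻¹ ∈ 𝓜.gc)
    {c : StepConsts} (hgcN : ∀ X ∈ 𝓜.gc, ∀ Y ∈ 𝓜.gc, c.ξ * (‖X‖ + ‖Y‖) ≤ 1 / 4 → newPot c.ξ X Y ∈ 𝓜.gc)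
    (Rz : Residual P 𝔸) (M j : ℕ) (Y : Set (Site P 0)) (hξ : 0 < c.ξ) (hcB : 0 ≤ c.cB)
    {α₀ γ₀ a a₁ δ₀ δ₁ s₀ s₁ α₀' α₁' γ₀' : ℝ} (hα₀ : 0 ≤ α₀) (ha : 0 ≤ a) (hδ₀ : 0 ≤ δ₀)
    (hs : c.ξ * (a + 2 * δ₀) ≤ 1 / 16)
    (hα₀' : Real.exp (2 * (c.ξ * δ₀)) * α₀ ≤ α₀') (hγ₀' : Real.exp (2 * (c.ξ * δ₀)) * γ₀ ≤ γ₀')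
    (hα₁'0 : s₀ + 4 * c.ξ * δ₀ * (a + δ₀) ≤ α₁')
    (hα₁'1 : s₁ + (4 * c.ξ * (δ₀ * a₁ + a * (2 * c.ξ * α₀ * δ₀ + δ₁)) +
        4 * c.ξ * ((a + (9 / 8) * δ₀) * δ₁ +
          δ₀ * ((1 + 4 * (c.ξ * δ₀)) * a₁ + (1 + 4 * (c.ξ * a)) * (2 * c.ξ * α₀ * δ₀ + δ₁)))) ≤ α₁')
    {Φ : FieldPair P 0 𝔸ˣ 𝔸} (hUGc : ∀ b ∈ (frameI Rz M j Y).X.bonds, Φ.U b ∈ 𝓜.Gc) (hJgc : ∀ b ∈ (frameI Rz M j Y).X.bonds, Φ.J b ∈ 𝓜.gc)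
    {U : PBond P 0 → 𝔸ˣ} {A' : PBond P 0 → 𝔸} (hf : Factors c Φ.U U A') (hI : CondI 𝓜 (frameI Rz M j Y) c α₀ U)
    (hAgc : ∀ b ∈ (frameI Rz M j Y).X.bonds, A' b ∈ 𝓜.gc) (hA : ∀ b ∈ (frameI Rz M j Y).X.bonds, ‖A' b‖ ≤ a)
    (hA1 : ∀ q ∈ (frameI Rz M j Y).X.dpairs, ‖nabla c.ξ U q.2.1 (fun y => A' ⟨y, q.2.2⟩) q.1‖ ≤ a₁)
    (hIII : CondIII (frameI Rz M j Y).X c α₀ γ₀ Φ.U Φ.J)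
    {l : Site P 0 → 𝔸} (hlgc : ∀ x ∈ Y, l x ∈ 𝓜.gc)
    (hlGc : ∀ x ∈ Y, Beta.BackgroundVertices.expUnit ℂ (-l x) ∈ 𝓜.Gc)
    (hgcl : ∀ x ∈ Y, ∀ X ∈ 𝓜.gc,
      (Beta.BackgroundVertices.expUnit ℂ (-l x) : 𝔸) * X * ↑(Beta.BackgroundVertices.expUnit ℂ (-l x))⁻¹ ∈ 𝓜.gc)
    (hl0 : ∀ x ∈ Y, ‖l x‖ ≤ c.ξ * δ₀)
    (hl1 : ∀ (x : Site P 0) (μ : Fin P.d), x ∈ Y → x.shift μ ∈ Y → ‖nabla c.ξ U μ l x‖ ≤ c.ξ * δ₁)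
    (hS0 : ∀ b ∈ (frameI Rz M j Y).X.bonds, ‖A' b - I • nabla c.ξ U b.dir l b.src‖ < s₀)
    (hS1 : ∀ q ∈ (frameI Rz M j Y).X.dpairs, ‖nabla c.ξ U q.2.1 (fun y => A' ⟨y, q.2.2⟩ - I • nabla c.ξ U q.2.2 l y) q.1‖ < s₁) :
    SatisfiesI_III 𝓜 (frameI Rz M j Y) c α₀' α₁' γ₀' (act (fun x => Beta.BackgroundVertices.expUnit ℂ (-l x)) Φ) := by
  have hξ0 : c.ξ ≠ 0 := hξ.ne'
  -- the generator `E = (i/ξ)•l`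
  set E : Site P 0 → 𝔸 := fun y => (I * (c.ξ : ℂ)⁻¹) • l y with hEdef
  have hnI : ‖(I * (c.ξ : ℂ)⁻¹)‖ = c.ξ⁻¹ := by
    rw [norm_mul, Complex.norm_I, one_mul, norm_inv, Complex.norm_real, Real.norm_eq_abs, abs_of_pos hξ]
  have he : (fun x => Beta.BackgroundVertices.expUnit ℂ (-l x)) = (1 : Site P 0 → 𝔸ˣ) * fun x => expI c.ξ (E x) := by
    funext x
    simp only [Pi.mul_apply, Pi.one_apply, one_mul, hEdef, expI_comb hξ0]
  have heq : ∀ x, expI c.ξ (E x) = Beta.BackgroundVertices.expUnit ℂ (-l x) := fun x => expI_comb hξ0 (l x)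
  have hE0 : ∀ x ∈ Y, ‖E x‖ ≤ δ₀ := fun x hx => by
    rw [hEdef]; dsimp only
    rw [norm_smul, hnI]
    calc c.ξ⁻¹ * ‖l x‖ ≤ c.ξ⁻¹ * (c.ξ * δ₀) := mul_le_mul_of_nonneg_left (hl0 x hx) (inv_nonneg.mpr hξ.le)
      _ = δ₀ := by field_simp
  have hE1 : ∀ (x : Site P 0) (μ : Fin P.d), x ∈ Y → x.shift μ ∈ Y → ‖nabla c.ξ U μ E x‖ ≤ δ₁ := fun x μ hx hxμ => by
    rw [hEdef, nabla_const_smul, norm_smul, hnI]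
    calc c.ξ⁻¹ * ‖nabla c.ξ U μ l x‖ ≤ c.ξ⁻¹ * (c.ξ * δ₁) :=
        mul_le_mul_of_nonneg_left (hl1 x μ hx hxμ) (inv_nonneg.mpr hξ.le)
      _ = δ₁ := by field_simp
  -- the first-order sum in the two presentations
  have hSpt : ∀ (y : Site P 0) (ν : Fin P.d),
      E y + A' ⟨y, ν⟩ + (U ⟨y, ν⟩ : 𝔸) * (-E (y.shift ν)) * ↑(U ⟨y, ν⟩)⁻¹ = A' ⟨y, ν⟩ - I • nabla c.ξ U ν l y :=
    fun y ν => by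
      have h := firstOrder_comb hξ0 U l y ν
      rw [hEdef]; dsimp only
      rw [add_right_comm, h, sub_eq_add_neg, add_comm]
  have hS0' : ∀ b ∈ (frameI Rz M j Y).X.bonds, ‖E b.src + A' b + (U b : 𝔸) * (-E b.tgt) * ↑(U b)⁻¹‖ < s₀ := by
    rintro ⟨y, ν⟩ hb
    rw [show (⟨y, ν⟩ : PBond P 0).tgt = y.shift ν from rfl, hSpt y ν]
    exact hS0 ⟨y, ν⟩ hb
  have hS1' : ∀ q ∈ (frameI Rz M j Y).X.dpairs, ‖nabla c.ξ U q.2.1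
      (fun y => E y + A' ⟨y, q.2.2⟩ + (U ⟨y, q.2.2⟩ : 𝔸) * (-E (y.shift q.2.2)) * ↑(U ⟨y, q.2.2⟩)⁻¹) q.1‖ < s₁ :=
    fun q hq => by
      have hfun : (fun y => E y + A' ⟨y, q.2.2⟩ + (U ⟨y, q.2.2⟩ : 𝔸) * (-E (y.shift q.2.2)) * ↑(U ⟨y, q.2.2⟩)⁻¹) =
          fun y => A' ⟨y, q.2.2⟩ - I • nabla c.ξ U q.2.2 l y := funext fun y => hSpt y q.2.2
      rw [hfun]
      exact hS1 q hq
  rw [he]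
  exact satisfiesI_III_act_near_firstOrder_frameI hG1 hGc hgc hgcN Rz M j Y hξ hcB hα₀ ha hδ₀ hs hα₀' hγ₀' hα₁'0 hα₁'1 hUGc
    hJgc hf hI hAgc hA hA1 hIII (fun _ => 𝓜.G.one_mem) (fun x hx => 𝓜.gc.smul_mem _ (hlgc x hx))
    (fun x hx => by rw [heq]; exact hlGc x hx) (fun x hx X hX => by rw [heq]; exact hgcl x hx X hX) hE0 hE1 hS0' hS1'


/-- ★★ **The (T3′) consequent, literally**: with the comb generator `l` such that `exp(−l(x)) ∈ Gᶜ` at EVERY site (off `Y` take `l = 0`), the data of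
`satisfiesI_III_act_comb_firstOrder_frameI` produce the orbit statement `∃ w, (∀ x, w x ∈ Gᶜ) ∧ SatisfiesI_III 𝓜 (frameI Rz M j Y) c α₀′ α₁′ γ₀′ (act w Φ)`
— the shape of the consequent of `hsat` in `YMDAG.N18.TransportReduction.hTsp_spaceOfRecord_unit_of_unitsTransport_orbit` (module 21 v1.1, at
`Φ := TΦ Φ₀`, `Rz := Residual.unit`, `c := StepConsts.ofParams …`, `γ₀′ := α₀′`). -/
theorem exists_orbit_comb_firstOrder_frameI (hG1 : ∀ g ∈ 𝓜.G, ‖(g : 𝔸)‖ ≤ 1) (hGc : 𝓜.G ≤ 𝓜.Gc)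
    (hgc : ∀ g ∈ 𝓜.G, ∀ X ∈ 𝓜.gc, (g : 𝔸) * X * ↑g⁻¹ ∈ 𝓜.gc)
    {c : StepConsts} (hgcN : ∀ X ∈ 𝓜.gc, ∀ Y ∈ 𝓜.gc, c.ξ * (‖X‖ + ‖Y‖) ≤ 1 / 4 → newPot c.ξ X Y ∈ 𝓜.gc)
    (Rz : Residual P 𝔸) (M j : ℕ) (Y : Set (Site P 0)) (hξ : 0 < c.ξ) (hcB : 0 ≤ c.cB)
    {α₀ γ₀ a a₁ δ₀ δ₁ s₀ s₁ α₀' α₁' γ₀' : ℝ} (hα₀ : 0 ≤ α₀) (ha : 0 ≤ a) (hδ₀ : 0 ≤ δ₀)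
    (hs : c.ξ * (a + 2 * δ₀) ≤ 1 / 16)
    (hα₀' : Real.exp (2 * (c.ξ * δ₀)) * α₀ ≤ α₀') (hγ₀' : Real.exp (2 * (c.ξ * δ₀)) * γ₀ ≤ γ₀')
    (hα₁'0 : s₀ + 4 * c.ξ * δ₀ * (a + δ₀) ≤ α₁')
    (hα₁'1 : s₁ + (4 * c.ξ * (δ₀ * a₁ + a * (2 * c.ξ * α₀ * δ₀ + δ₁)) +
        4 * c.ξ * ((a + (9 / 8) * δ₀) * δ₁ +
          δ₀ * ((1 + 4 * (c.ξ * δ₀)) * a₁ + (1 + 4 * (c.ξ * a)) * (2 * c.ξ * α₀ * δ₀ + δ₁)))) ≤ α₁')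
    {Φ : FieldPair P 0 𝔸ˣ 𝔸} (hUGc : ∀ b ∈ (frameI Rz M j Y).X.bonds, Φ.U b ∈ 𝓜.Gc)
    (hJgc : ∀ b ∈ (frameI Rz M j Y).X.bonds, Φ.J b ∈ 𝓜.gc)
    {U : PBond P 0 → 𝔸ˣ} {A' : PBond P 0 → 𝔸} (hf : Factors c Φ.U U A') (hI : CondI 𝓜 (frameI Rz M j Y) c α₀ U)
    (hAgc : ∀ b ∈ (frameI Rz M j Y).X.bonds, A' b ∈ 𝓜.gc) (hA : ∀ b ∈ (frameI Rz M j Y).X.bonds, ‖A' b‖ ≤ a)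
    (hA1 : ∀ q ∈ (frameI Rz M j Y).X.dpairs, ‖nabla c.ξ U q.2.1 (fun y => A' ⟨y, q.2.2⟩) q.1‖ ≤ a₁)
    (hIII : CondIII (frameI Rz M j Y).X c α₀ γ₀ Φ.U Φ.J)
    {l : Site P 0 → 𝔸} (hlgc : ∀ x ∈ Y, l x ∈ 𝓜.gc)
    (hlGc : ∀ x, Beta.BackgroundVertices.expUnit ℂ (-l x) ∈ 𝓜.Gc)
    (hgcl : ∀ x ∈ Y, ∀ X ∈ 𝓜.gc,
      (Beta.BackgroundVertices.expUnit ℂ (-l x) : 𝔸) * X * ↑(Beta.BackgroundVertices.expUnit ℂ (-l x))⁻¹ ∈ 𝓜.gc)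
    (hl0 : ∀ x ∈ Y, ‖l x‖ ≤ c.ξ * δ₀)
    (hl1 : ∀ (x : Site P 0) (μ : Fin P.d), x ∈ Y → x.shift μ ∈ Y → ‖nabla c.ξ U μ l x‖ ≤ c.ξ * δ₁)
    (hS0 : ∀ b ∈ (frameI Rz M j Y).X.bonds, ‖A' b - I • nabla c.ξ U b.dir l b.src‖ < s₀)
    (hS1 : ∀ q ∈ (frameI Rz M j Y).X.dpairs,
      ‖nabla c.ξ U q.2.1 (fun y => A' ⟨y, q.2.2⟩ - I • nabla c.ξ U q.2.2 l y) q.1‖ < s₁) :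
    ∃ w : Site P 0 → 𝔸ˣ, (∀ x, w x ∈ 𝓜.Gc) ∧ SatisfiesI_III 𝓜 (frameI Rz M j Y) c α₀' α₁' γ₀' (act w Φ) :=
  ⟨fun x => Beta.BackgroundVertices.expUnit ℂ (-l x), hlGc,
    satisfiesI_III_act_comb_firstOrder_frameI hG1 hGc hgc hgcN Rz M j Y hξ hcB hα₀ ha hδ₀ hs hα₀' hγ₀' hα₁'0 hα₁'1 hUGc
      hJgc hf hI hAgc hA hA1 hIII hlgc (fun x _ => hlGc x) hgcl hl0 hl1 hS0 hS1⟩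


end Lattice

/-! ## §3 The `SU(N)` model of record (`Node00.Record12`: `𝓜 := suModel N`, `𝔸 = M_N(ℂ)` with the `L²`-operator norm): the standing
provisos discharged by `B12RegularSpaces111SpecialUnitary` (`hgcN` in its STEP form `suModel_gc_newPot`), the comb generator traceless -/

section SpecialUnitary

open scoped Matrix.Norms.L2Operator
open Literature.MathematicalPhysics.QuantumFieldTheory.Balaban1983to89.B12RegularSpaces111SpecialUnitary
open Literature.MathematicalPhysics.QuantumFieldTheory.Balaban1983to89.Node00
open Literature.MathematicalPhysics.QuantumFieldTheory.Balaban1983to89.Node00.Sect2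

variable {N : ℕ} {P : Params}

/-- ★★★ **(T3′)'s consequent in the `SU(N)` model of record, provisos discharged**: `G = SU(N)`, `Gᶜ = SL(N, ℂ)`, `𝔤ᶜ = 𝔰𝔩(N, ℂ)`;
`A′` traceless on the bonds of `X`, the comb generator `l` traceless EVERYWHERE (off `Y` take `l = 0`), so that `w = exp(−l)` is `SL(N, ℂ)`-valued
(`suModel_expI_mem_Gc` through `expI_comb`) and `Ad(w)` preserves `𝔰𝔩(N, ℂ)` (`suModel_gc_conjE`). -/
theorem exists_orbit_comb_firstOrder_frameI_su (Rz : Residual P (Matrix (Fin N) (Fin N) ℂ)) (M j : ℕ) (Y : Set (Site P 0))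
    {c : StepConsts} (hξ : 0 < c.ξ) (hcB : 0 ≤ c.cB)
    {α₀ γ₀ a a₁ δ₀ δ₁ s₀ s₁ α₀' α₁' γ₀' : ℝ} (hα₀ : 0 ≤ α₀) (ha : 0 ≤ a) (hδ₀ : 0 ≤ δ₀)
    (hs : c.ξ * (a + 2 * δ₀) ≤ 1 / 16)
    (hα₀' : Real.exp (2 * (c.ξ * δ₀)) * α₀ ≤ α₀') (hγ₀' : Real.exp (2 * (c.ξ * δ₀)) * γ₀ ≤ γ₀')
    (hα₁'0 : s₀ + 4 * c.ξ * δ₀ * (a + δ₀) ≤ α₁')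
    (hα₁'1 : s₁ + (4 * c.ξ * (δ₀ * a₁ + a * (2 * c.ξ * α₀ * δ₀ + δ₁)) +
        4 * c.ξ * ((a + (9 / 8) * δ₀) * δ₁ +
          δ₀ * ((1 + 4 * (c.ξ * δ₀)) * a₁ + (1 + 4 * (c.ξ * a)) * (2 * c.ξ * α₀ * δ₀ + δ₁)))) ≤ α₁')
    {Φ : FieldPair P 0 (Matrix (Fin N) (Fin N) ℂ)ˣ (Matrix (Fin N) (Fin N) ℂ)}
    (hUGc : ∀ b ∈ (frameI Rz M j Y).X.bonds, Φ.U b ∈ (suModel N).Gc)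
    (hJgc : ∀ b ∈ (frameI Rz M j Y).X.bonds, Φ.J b ∈ (suModel N).gc)
    {U : PBond P 0 → (Matrix (Fin N) (Fin N) ℂ)ˣ} {A' : PBond P 0 → Matrix (Fin N) (Fin N) ℂ} (hf : Factors c Φ.U U A')
    (hI : CondI (suModel N) (frameI Rz M j Y) c α₀ U)
    (hAtr : ∀ b ∈ (frameI Rz M j Y).X.bonds, (A' b).trace = 0) (hA : ∀ b ∈ (frameI Rz M j Y).X.bonds, ‖A' b‖ ≤ a)
    (hA1 : ∀ q ∈ (frameI Rz M j Y).X.dpairs, ‖nabla c.ξ U q.2.1 (fun y => A' ⟨y, q.2.2⟩) q.1‖ ≤ a₁)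
    (hIII : CondIII (frameI Rz M j Y).X c α₀ γ₀ Φ.U Φ.J)
    {l : Site P 0 → Matrix (Fin N) (Fin N) ℂ} (hl : ∀ x, (l x).trace = 0)
    (hl0 : ∀ x ∈ Y, ‖l x‖ ≤ c.ξ * δ₀)
    (hl1 : ∀ (x : Site P 0) (μ : Fin P.d), x ∈ Y → x.shift μ ∈ Y → ‖nabla c.ξ U μ l x‖ ≤ c.ξ * δ₁)
    (hS0 : ∀ b ∈ (frameI Rz M j Y).X.bonds, ‖A' b - I • nabla c.ξ U b.dir l b.src‖ < s₀)
    (hS1 : ∀ q ∈ (frameI Rz M j Y).X.dpairs,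
      ‖nabla c.ξ U q.2.1 (fun y => A' ⟨y, q.2.2⟩ - I • nabla c.ξ U q.2.2 l y) q.1‖ < s₁) :
    ∃ w : Site P 0 → (Matrix (Fin N) (Fin N) ℂ)ˣ, (∀ x, w x ∈ (suModel N).Gc) ∧
      SatisfiesI_III (suModel N) (frameI Rz M j Y) c α₀' α₁' γ₀' (act w Φ) := by
  have hξ0 : c.ξ ≠ 0 := hξ.ne'
  have htr : ∀ x, ((I * (c.ξ : ℂ)⁻¹) • l x).trace = 0 := fun x => by rw [Matrix.trace_smul, hl x, smul_zero]
  have heq : ∀ x, Beta.BackgroundVertices.expUnit ℂ (-l x) = expI c.ξ ((I * (c.ξ : ℂ)⁻¹) • l x) :=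
    fun x => (expI_comb hξ0 (l x)).symm
  refine exists_orbit_comb_firstOrder_frameI suModel_norm_le suModel_G_le_Gc suModel_gc_conj (suModel_gc_newPot hξ.le) Rz M j Y
    hξ hcB hα₀ ha hδ₀ hs hα₀' hγ₀' hα₁'0 hα₁'1 hUGc hJgc hf hI (fun b hb => mem_suModel_gc.2 (hAtr b hb)) hA hA1 hIII
    (fun x _ => mem_suModel_gc.2 (hl x)) (fun x => ?_) (fun x _ X hX => ?_) hl0 hl1 hS0 hS1
  · rw [heq]; exact suModel_expI_mem_Gc c.ξ htr x
  · rw [heq]; exact suModel_gc_conjE c.ξ (fun y => (I * (c.ξ : ℂ)⁻¹) • l y) x X hX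

end SpecialUnitary

end

end YMDAG.N18.CombStep
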